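import Summits.ResolutionOfSingularities.ResolutionOfSingularities.Theorems.PurelyInseparableDim4IsolatedScope
import Summits.ResolutionOfSingularities.ResolutionOfSingularities.Theorems.PurelyInseparableDim4Perm2BoundOrigin
import Literature.AlgebraicGeometry.Resolution.CentreBlowupOrdAlongBasics
import Literature.AlgebraicGeometry.Resolution.PointBlowupMohBound
import Literature.RingTheory.MvPolynomial.LinearFormIdealsHeight
import Mathlib.RingTheory.Ideal.KrullsHeightTheorem
import Mathlib.RingTheory.MvPolynomial.Ideal
import HarnessLib

/-!
# [OURS · res-dim4-pi PR-12] The ISOLATED BAND: a state of order `≥ 2q − 1` along the centre has no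
  isolated successor

Cell `res-dim4-pi` (D-0157 DOOR 2), frame v4 TIER 1 (I) = the ISOLATED regime `F4-I NoIsolatedTrap`
(desk `boards/ROUTES.md` WORD #20 (c), Scope add-on `PurelyInseparableDim4Scope` = TY-8); brick **PR-12
«ISOLATED BAND»** (seat `res-dim4-p-5`, width copy of the `res-dim4-p-1` row; proposed on the cell bus
2026-08-28T16:22Z). DEF-FREE; typed over the TREE's coordinate-centre model `CentreBlowup.step / ordAlong /
chartExponent / chartTransform` (`PointBlowupShadeCentres.lean`, `CentreBlowupOrdAlongBasics.lean`), the
point-blow-up translation lemmas (`PointBlowupMohBound.lean`), p-2's chart-origin dictionary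
(`Perm2Bound.exists_of_mem_support_chartTransform`), the Scope add-on's `hasseDeriv / singLocusIdeal /
originIdeal / IsIsolated`, p-12's `IsolatedScope` (PR-8: `X_mem_originIdeal`, `step1h_iff_step0_of_isIsolated`,
`stepRule_iff_step0_of_isIsolated`), the tree's `LinearFormIdealsHeight.card_le_height_span` and Mathlib's Krull height
theorem — cited, nothing restated.

## What is proved (every field `K`, EVERY exponent `q ≥ 2`, every coordinate centre `S`, every chart `j`,
## every chart point `b` with `b_j = 0`; NO permissibility / equimultiplicity / cleanness hypothesis)

* §1 `four_le_height_originIdeal` (`ht 𝔪₀ ≥ 4`), `not_isIsolated_of_le_ordAlong_singleton`, **`not_isIsolated_of_le_span_pair`**: if the `q`-fold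
  locus ideal `J_q⁺(G)` lies in an ideal generated by TWO elements of `𝔪₀`, the origin is NOT an isolated
  `q`-fold point (a minimal prime of a 2-generated ideal has height `≤ 2 < 4`).
* §2 `apply_ge_of_mem_support_step` — **the `x_j`-layers of a successor**: every monomial `x^e` of
  `(step q S j b s).F` has `e_j ≥ ord_{(x_S)} F − q` (chart law `e′_j = degIn S d − q`; translation with
  `b_j = 0` and cleaning do not touch the `x_j`-exponent).
* §3 **`singLocusIdeal_le_span_pair_of_layer`** — THE LAYER LEMMA: if every monomial of `P` has
  `x_j`-exponent `≥ q − 1`, then `J_q⁺(P) ≤ (x_j, D^{((q−1)·e_j)} P)` (every other Hasse derivative of order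
  `< q` lands in `(x_j)`).
* §4 **`not_isIsolated_step_of_le_ordAlong` — THE BAND THEOREM**: `2q − 1 ≤ ord_{(x_S)} s.F ⇒
  ¬ IsIsolated q (step q S j b s).F`. Frame corollaries: `not_isIsolated_of_edge`,
  `ordAlong_le_of_edge_of_isIsolated` (an isolated successor forces `ord_{(x_S)} F ≤ 2q − 2`),
  `ordZero_le_of_step0_of_isIsolated`, **`isolated_chain_band`** (along every `Step0`-chain of ISOLATED
  states `q ≤ ord₀ F_k ≤ 2q − 2` for all `k`) and **`isolated_chain_ordZero_eq_two`** (`q = 2`: `ord₀ F_k = 2`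
  THROUGHOUT — the regime where `NoIsolatedTrap 2 2` lives is the quadratic-part regime).

Census reading (cell boards, Q-ISO / W3-6): states with `ord ≥ 2q − 1` never have isolated successors and
can be pruned from isolated-regime searches; at `p = 2` only order-2 states matter.
[OURS · counted 0 · AI work weaker than expert review] Nothing here proves `NoIsolatedTrap` or resolution of
singularities in dimension ≥ 4 / characteristic `p`; structural bookkeeping about OUR candidate frame.
bears_on: LADDER-RESOLUTION:D157-DOOR2 (res-dim4-pi · PR-12). Supports stmt-ResolutionOfSingularities-16155
(helper).
-/

set_option linter.dupNamespace false -- mandated namespace of this single-conjunct summit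

noncomputable section

namespace Summit.ResolutionOfSingularities.ResolutionOfSingularities.Theorems.PIDim4

namespace IsolatedBand

open MvPolynomial Finset
open Literature.AlgebraicGeometry.Resolution
open Literature.AlgebraicGeometry.Resolution.CentreBlowup
open Literature.AlgebraicGeometry.Resolution.Hauser2010

variable {K : Type} [Field K]

/-! ## §1 The origin has height four; two generators in `𝔪₀` never isolate it -/

/-- `𝔪₀` is prime (the kernel of the evaluation at the origin, a map onto a field). [folklore] -/
theorem originIdeal_isPrime : (originIdeal K).IsPrime :=
  RingHom.ker_isPrime _

/-- **`ht 𝔪₀ ≥ 4`**: the four variables are linearly independent linear forms in `𝔪₀`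
(`LinearFormIdealsHeight.card_le_height_span`). [folklore] -/
theorem four_le_height_originIdeal : (4 : ℕ∞) ≤ (originIdeal K).height := by
  classical
  set s : Finset (MvPolynomial (Fin 4) K) := Finset.univ.image X with hs
  have hcoe : (s : Set (MvPolynomial (Fin 4) K)) = Set.range (X : Fin 4 → MvPolynomial (Fin 4) K) := by
    rw [hs, Finset.coe_image, Finset.coe_univ, Set.image_univ]
  have hcard : s.card = 4 := by
    rw [hs, Finset.card_image_of_injective _ (X_injective (σ := Fin 4) (R := K)), Finset.card_univ,
      Fintype.card_fin]
  have h1 : ∀ ℓ ∈ s, ℓ.IsHomogeneous 1 := by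
    intro ℓ hℓ
    rw [hs, Finset.mem_image] at hℓ
    obtain ⟨i, -, rfl⟩ := hℓ
    exact isHomogeneous_X K i
  have hli : LinearIndepOn K id (s : Set (MvPolynomial (Fin 4) K)) := by
    rw [hcoe]
    exact (linearIndependent_X (R := K) (Fin 4)).linearIndepOn_id
  have h4 := Literature.RingTheory.MvPolynomial.LinearFormIdealsHeight.card_le_height_span h1 hli
  rw [hcard] at h4
  have hle : Ideal.span (s : Set (MvPolynomial (Fin 4) K)) ≤ originIdeal K := by
    rw [Ideal.span_le, hcoe]
    rintro _ ⟨i, rfl⟩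
    exact IsolatedScope.X_mem_originIdeal i
  exact le_trans (by exact_mod_cast h4) (Ideal.height_mono hle)

/-- **Two generators in `𝔪₀` never make the origin an isolated `q`-fold point**: if
`J_q⁺(G) ≤ (f, g)` with `f, g ∈ 𝔪₀`, then some minimal prime of `J_q⁺(G)` lies STRICTLY inside `𝔪₀`
(below a minimal prime of `(f, g)`, which has height `≤ 2 < 4 ≤ ht 𝔪₀` by Krull's height theorem).
[folklore] -/
theorem not_isIsolated_of_le_span_pair {q : ℕ} {G f g : MvPolynomial (Fin 4) K}
    (hJ : singLocusIdeal q G ≤ Ideal.span {f, g}) (hf : f ∈ originIdeal K)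
    (hg : g ∈ originIdeal K) : ¬ IsIsolated q G := by
  classical
  haveI := originIdeal_isPrime (K := K)
  have hI : Ideal.span ({f, g} : Set (MvPolynomial (Fin 4) K)) ≤ originIdeal K := by
    rw [Ideal.span_le]
    rintro x hx
    rcases hx with rfl | hx
    · exact hf
    · rw [Set.mem_singleton_iff] at hx
      subst hx
      exact hg
  obtain ⟨P₁, hP₁, hP₁le⟩ := Ideal.exists_minimalPrimes_le hI
  haveI hP₁prime : P₁.IsPrime := hP₁.1.1
  -- Krull: `ht P₁ ≤ 2`
  have hht : P₁.height ≤ 2 := by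
    have hset : ({f, g} : Set (MvPolynomial (Fin 4) K)) = (({f, g} : Finset _) : Set _) := by
      rw [Finset.coe_insert, Finset.coe_singleton]
    rw [hset] at hP₁
    refine le_trans (Ideal.height_le_card_of_mem_minimalPrimes_span_finset hP₁) ?_
    exact_mod_cast Finset.card_le_two
  have hne : P₁ ≠ originIdeal K := by
    intro h
    rw [h] at hht
    have h4 := four_le_height_originIdeal (K := K)
    have : (4 : ℕ∞) ≤ 2 := le_trans h4 hht
    exact absurd this (by decide)
  rintro ⟨-, hall⟩
  obtain ⟨P, hP, hPle⟩ := Ideal.exists_minimalPrimes_le (hJ.trans hP₁.1.2)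
  have hP𝔪 : P = originIdeal K := hall P hP (hPle.trans hP₁le)
  exact hne (le_antisymm hP₁le (hP𝔪 ▸ hPle))

/-- A ONE-generator version: `J_q⁺(G) ≤ (f)` with `f ∈ 𝔪₀` is not isolated either. [folklore] -/
theorem not_isIsolated_of_le_span_singleton {q : ℕ} {G f : MvPolynomial (Fin 4) K}
    (hJ : singLocusIdeal q G ≤ Ideal.span {f}) (hf : f ∈ originIdeal K) : ¬ IsIsolated q G :=
  not_isIsolated_of_le_span_pair (g := f)
    (hJ.trans (Ideal.span_mono (Set.singleton_subset_iff.mpr (Set.mem_insert_of_mem _ rfl)))) hf hf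

/-- **Hasse derivatives stay in `(x_j)` below the `x_j`-layer**: if every monomial of `P` has
`x_j`-exponent `≥ n` and `α_j < n`, then `D^{(α)} P ∈ (x_j)` (the monomial `x^{d − α}` of `D^{(α)}(x^d)`
keeps `x_j`-exponent `d_j − α_j ≥ 1`). [cite: Giraud1975, §1 (Hasse–Schmidt derivations)] [folklore] -/
theorem hasseDeriv_mem_span_X_of_layer {n : ℕ} {j : Fin 4} {P : MvPolynomial (Fin 4) K}
    (hP : ∀ e ∈ P.support, n ≤ e j) {α : Fin 4 →₀ ℕ} (hαj : α j < n) :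
    hasseDeriv α P ∈ Ideal.span {(X j : MvPolynomial (Fin 4) K)} := by
  classical
  unfold hasseDeriv
  refine Ideal.sum_mem _ fun d hd => ?_
  have himg : Ideal.span {(X j : MvPolynomial (Fin 4) K)} =
      Ideal.span ((fun i => (X i : MvPolynomial (Fin 4) K)) '' ({j} : Set (Fin 4))) := by
    rw [Set.image_singleton]
  rw [himg]
  refine MvPolynomial.mem_ideal_span_X_image.mpr fun m hm => ⟨j, Set.mem_singleton j, ?_⟩
  have hm' : m = d - α := Finset.mem_singleton.mp (MvPolynomial.support_monomial_subset hm)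
  subst hm'
  rw [Finsupp.tsub_apply]
  have hdj := hP d hd
  omega

/-- In particular **`q ≤ ord_{(x_j)} G` (the hyperplane `x_j = 0` lies in the `q`-fold locus) ⇒
`J_q⁺(G) ≤ (x_j)` and the origin is not isolated** — the one-variable case of «a permissible centre forces
the point» (PR-8) read negatively. [folklore] -/
theorem not_isIsolated_of_le_ordAlong_singleton {q : ℕ} {G : MvPolynomial (Fin 4) K} (j : Fin 4)
    (hq : (q : ℕ∞) ≤ ordAlong {j} G) : ¬ IsIsolated q G := by
  classical
  refine not_isIsolated_of_le_span_singleton (f := X j) ?_ (IsolatedScope.X_mem_originIdeal j)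
  unfold singLocusIdeal
  rw [Ideal.span_le]
  rintro _ ⟨α, -, hαq, rfl⟩
  have hP : ∀ e ∈ G.support, q ≤ e j := fun e he => by
    have := (le_ordAlong_iff.mp hq) e he
    rw [degIn_singleton] at this
    exact_mod_cast this
  have hαj : α j < q := lt_of_le_of_lt (by
    rw [Finsupp.degree_eq_sum]
    exact Finset.single_le_sum (fun i _ => Nat.zero_le (α i)) (Finset.mem_univ j)) hαq
  exact hasseDeriv_mem_span_X_of_layer hP hαj

/-! ## §2 The `x_j`-layers of a successor -/

omit [Field K] in
/-- Every monomial `x^e` of the chart transform is a chart image: `e_j = degIn S d − q` for a monomial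
`x^d` of `F`; hence `e_j ≥ m − q` whenever `m ≤ ord_{(x_S)} F`. [folklore] -/
theorem apply_ge_of_mem_support_chartTransform {K : Type} [Field K] {q m : ℕ} {S : Finset (Fin 4)}
    {j : Fin 4} {F : MvPolynomial (Fin 4) K} (hm : (m : ℕ∞) ≤ ordAlong S F) {E : Fin 4 →₀ ℕ}
    (hE : E ∈ (chartTransform q S j F).support) : m - q ≤ E j := by
  classical
  obtain ⟨d, hd, rfl⟩ := Perm2Bound.exists_of_mem_support_chartTransform q S j F hE
  rw [chartExponent_apply_self]
  have := (le_ordAlong_iff.mp hm) d hd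
  have hmd : m ≤ degIn S d := by exact_mod_cast this
  omega

/-- Translation with `b_j = 0` keeps the `x_j`-exponent of every monomial. [folklore] -/
theorem exists_apply_eq_of_mem_support_translate {b : Fin 4 → K} {j : Fin 4} (hbj : b j = 0)
    (P : MvPolynomial (Fin 4) K) {e : Fin 4 →₀ ℕ} (he : e ∈ (PointBlowup.translate b P).support) :
    ∃ E ∈ P.support, e j = E j := by
  classical
  rw [MvPolynomial.mem_support_iff, PointBlowup.translate_eq_sum_support, coeff_sum] at he
  obtain ⟨E, hE, hne⟩ := Finset.exists_ne_zero_of_sum_ne_zero he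
  exact ⟨E, hE, PointBlowup.apply_eq_of_coeff_translate_monomial_ne_zero b hbj hne⟩

omit [Field K] in
/-- Cleaning only deletes monomials. [folklore] -/
theorem mem_support_of_mem_support_deletePthPowers' {K : Type} [Field K] (q : ℕ)
    (P : MvPolynomial (Fin 4) K) {e : Fin 4 →₀ ℕ} (he : e ∈ (deletePthPowers q P).support) :
    e ∈ P.support := by
  classical
  rw [MvPolynomial.mem_support_iff] at he ⊢
  rw [coeff_deletePthPowers] at he
  split_ifs at he with h
  · exact (he rfl).elim
  · exact he

/-- **The `x_j`-layers of a successor**: for `m ≤ ord_{(x_S)} F`, every monomial `x^e` of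
`(step q S j b s).F` (chart `j`, point `b` with `b_j = 0`, cleaned) has `e_j ≥ m − q`. [folklore] -/
theorem apply_ge_of_mem_support_step [DecidableEq K] {q m : ℕ} {S : Finset (Fin 4)} {j : Fin 4}
    {b : Fin 4 → K} (hbj : b j = 0) (s : State K) (hm : (m : ℕ∞) ≤ ordAlong S s.F)
    {e : Fin 4 →₀ ℕ} (he : e ∈ (step q S j b s).F.support) : m - q ≤ e j := by
  have he1 := mem_support_of_mem_support_deletePthPowers' q _ he
  obtain ⟨E, hE, heE⟩ := exists_apply_eq_of_mem_support_translate hbj _ he1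
  rw [heE]
  exact apply_ge_of_mem_support_chartTransform hm hE

/-! ## §3 The layer lemma: `J_q⁺(P) ≤ (x_j, D^{((q−1)·e_j)} P)` -/

/-- An exponent of total degree `< q` other than `(q−1)·e_j` has `j`-th coordinate `≤ q − 2`. [folklore] -/
theorem apply_le_sub_two_of_ne_single {q : ℕ} {j : Fin 4} {α : Fin 4 →₀ ℕ} (hαq : α.degree < q)
    (hne : α ≠ Finsupp.single j (q - 1)) : α j ≤ q - 2 := by
  classical
  by_contra hcon
  push Not at hcon
  apply hne
  have hsum : α.degree = α j + ∑ i ∈ Finset.univ.erase j, α i := by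
    rw [Finsupp.degree_eq_sum, ← Finset.add_sum_erase _ _ (Finset.mem_univ j)]
  have hj : α j = q - 1 := by omega
  have hrest : ∑ i ∈ Finset.univ.erase j, α i = 0 := by omega
  ext i
  by_cases hi : i = j
  · subst hi
    rw [Finsupp.single_eq_same, hj]
  · rw [Finsupp.single_eq_of_ne hi]
    exact Finset.sum_eq_zero_iff.mp hrest i (Finset.mem_erase.mpr ⟨hi, Finset.mem_univ i⟩)

/-- **THE LAYER LEMMA.** If every monomial of `P` has `x_j`-exponent `≥ q − 1`, then
`J_q⁺(P) ≤ (x_j, D^{((q−1)·e_j)} P)`: the Hasse derivative `D^{((q−1)·e_j)}` is the only one of order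
`< q` that can leave the ideal `(x_j)`. [folklore] -/
theorem singLocusIdeal_le_span_pair_of_layer {q : ℕ} {j : Fin 4} {P : MvPolynomial (Fin 4) K}
    (hP : ∀ e ∈ P.support, q - 1 ≤ e j) :
    singLocusIdeal q P ≤
      Ideal.span {(X j : MvPolynomial (Fin 4) K), hasseDeriv (Finsupp.single j (q - 1)) P} := by
  classical
  unfold singLocusIdeal
  rw [Ideal.span_le]
  rintro _ ⟨α, hα0, hαq, rfl⟩
  by_cases hα : α = Finsupp.single j (q - 1)
  · subst hα
    exact Ideal.subset_span (Set.mem_insert_of_mem _ rfl)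
  · have hαj := apply_le_sub_two_of_ne_single hαq hα
    have hq2 : 2 ≤ q := by omega
    have hmem := hasseDeriv_mem_span_X_of_layer hP (show α j < q - 1 by omega)
    exact Ideal.span_mono (Set.singleton_subset_iff.mpr (Set.mem_insert _ _)) hmem

/-! ## §4 The band theorem and its frame corollaries -/

/-- **THE BAND THEOREM.** For `q ≥ 2`, every field, every coordinate centre `S`, every chart `j` and
every chart point `b` with `b_j = 0`: if `ord_{(x_S)} F ≥ 2q − 1` then the successor state
`step q S j b s` is NOT an isolated `q`-fold point. (No permissibility, equimultiplicity or cleanness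
hypothesis: the `x_j^{q−1}`-layer of the successor carries its whole `q`-fold locus ideal modulo `(x_j)`.)
[folklore] -/
theorem not_isIsolated_step_of_le_ordAlong [DecidableEq K] {q : ℕ} (hq : 2 ≤ q) {S : Finset (Fin 4)}
    {j : Fin 4} {b : Fin 4 → K} (hbj : b j = 0) (s : State K)
    (hord : ((2 * q - 1 : ℕ) : ℕ∞) ≤ ordAlong S s.F) : ¬ IsIsolated q (step q S j b s).F := by
  classical
  set P := (step q S j b s).F with hPdef
  have hlayer : ∀ e ∈ P.support, q - 1 ≤ e j := by
    intro e he
    have := apply_ge_of_mem_support_step (q := q) hbj s hord he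
    omega
  have hJ := singLocusIdeal_le_span_pair_of_layer hlayer
  set D := hasseDeriv (Finsupp.single j (q - 1)) P with hDdef
  by_cases hD : D ∈ originIdeal K
  · exact not_isIsolated_of_le_span_pair hJ (IsolatedScope.X_mem_originIdeal j) hD
  · -- `D` is itself a generator of `J_q⁺(P)` (`0 < q − 1 < q`), so `J_q⁺(P) ≰ 𝔪₀`
    rintro ⟨hle, -⟩
    apply hD
    refine hle (Ideal.subset_span ⟨Finsupp.single j (q - 1), ?_, ?_, rfl⟩)
    · rw [Finsupp.degree_single]; omega
    · rw [Finsupp.degree_single]; omega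

/-- **Frame corollary (edges).** An `Edge q S s s'` from a state with `ord_{(x_S)} F ≥ 2q − 1` never
ends at an isolated state. [folklore] -/
theorem not_isIsolated_of_edge [DecidableEq K] {q : ℕ} (hq : 2 ≤ q) {S : Finset (Fin 4)}
    {s s' : State K} (h : Edge q S s s') (hord : ((2 * q - 1 : ℕ) : ℕ∞) ≤ ordAlong S s.F) :
    ¬ IsIsolated q s'.F := by
  obtain ⟨j, b, -, hbj, -, -, rfl⟩ := h
  exact not_isIsolated_step_of_le_ordAlong hq hbj s hord

/-- **An isolated successor forces `ord_{(x_S)} F ≤ 2q − 2`.** [folklore] -/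
theorem ordAlong_le_of_edge_of_isIsolated [DecidableEq K] {q : ℕ} (hq : 2 ≤ q) {S : Finset (Fin 4)}
    {s s' : State K} (h : Edge q S s s') (hiso : IsIsolated q s'.F) :
    ordAlong S s.F ≤ ((2 * q - 2 : ℕ) : ℕ∞) := by
  by_contra hcon
  push Not at hcon
  refine not_isIsolated_of_edge hq h ?_ hiso
  have h1 : ((2 * q - 2 : ℕ) : ℕ∞) + 1 ≤ ordAlong S s.F := Order.add_one_le_of_lt hcon
  have h2 : (2 * q - 1 : ℕ) = (2 * q - 2) + 1 := by omega
  rw [h2, Nat.cast_add, Nat.cast_one]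
  exact h1

/-- **Point blow-ups**: an isolated successor of a `Step0` edge forces `ord₀ F ≤ 2q − 2`. [folklore] -/
theorem ordZero_le_of_step0_of_isIsolated [DecidableEq K] {q : ℕ} (hq : 2 ≤ q) {s s' : State K}
    (h : Step0 q s s') (hiso : IsIsolated q s'.F) :
    ordZero s.F ≤ ((2 * q - 2 : ℕ) : ℕ∞) := by
  rw [← ordAlong_univ]
  exact ordAlong_le_of_edge_of_isIsolated hq h.2 hiso

/-- **THE ISOLATED BAND along chains.** Along every `Step0`-chain all of whose states are ISOLATED
`q`-fold points (the object `NoIsolatedTrap` forbids), `q ≤ ord₀ F_k ≤ 2q − 2` for every `k`.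
[folklore] -/
theorem isolated_chain_band [DecidableEq K] {q : ℕ} (hq : 2 ≤ q) {c : ℕ → State K}
    (hc : ∀ k, IsIsolated q (c k).F ∧ Step0 q (c k) (c (k + 1))) (k : ℕ) :
    (q : ℕ∞) ≤ ordZero (c k).F ∧
      ordZero (c k).F ≤ ((2 * q - 2 : ℕ) : ℕ∞) := by
  refine ⟨?_, ordZero_le_of_step0_of_isIsolated hq (hc k).2 (hc (k + 1)).1⟩
  rw [← ordAlong_univ]
  exact (hc k).2.1

/-- **`q = 2`: the isolated regime is the ORDER-TWO regime.** Along every `Step0`-chain of isolated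
`2`-fold points, `ord₀ F_k = 2` for every `k` (cubic-order states never have isolated successors).
[folklore] -/
theorem isolated_chain_ordZero_eq_two [DecidableEq K] {c : ℕ → State K}
    (hc : ∀ k, IsIsolated 2 (c k).F ∧ Step0 2 (c k) (c (k + 1))) (k : ℕ) :
    ordZero (c k).F = 2 := by
  obtain ⟨h1, h2⟩ := isolated_chain_band (le_refl 2) hc k
  exact le_antisymm (by exact_mod_cast h2) (by exact_mod_cast h1)

/-- `NoIsolatedTrap p q` restated on the band: it suffices to exclude chains of isolated states whose
orders stay in `[q, 2q − 2]`. [folklore] -/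
theorem noIsolatedTrap_iff_band (p q : ℕ) (hq : 2 ≤ q) :
    NoIsolatedTrap p q ↔ ∀ (K : Type) [Field K] [CharP K p] [DecidableEq K],
      ¬ ∃ c : ℕ → State K, ∀ k, IsIsolated q (c k).F ∧ Step0 q (c k) (c (k + 1)) ∧
        ordZero (c k).F ≤ ((2 * q - 2 : ℕ) : ℕ∞) := by
  constructor
  · intro h K _ _ _
    rintro ⟨c, hc⟩
    exact h K ⟨c, fun k => ⟨(hc k).1, (hc k).2.1⟩⟩
  · intro h K _ _ _
    rintro ⟨c, hc⟩
    exact h K ⟨c, fun k => ⟨(hc k).1, (hc k).2, (isolated_chain_band hq hc k).2⟩⟩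

/-- **The band under ANY permissible coordinate rule.** At isolated states every permissible rule takes
the point (p-12's `IsolatedScope.stepRule_iff_step0_of_isIsolated`), so along every `StepRule R`-chain of
isolated states the orders stay in `[q, 2q − 2]` as well. [folklore] -/
theorem isolated_ruleChain_band [DecidableEq K] {q : ℕ} (hq : 2 ≤ q) (R : CentreRule K)
    (hR : IsPermissibleRule q R) {c : ℕ → State K}
    (hc : ∀ k, IsIsolated q (c k).F ∧ StepRule q R (c k) (c (k + 1))) (k : ℕ) :
    (q : ℕ∞) ≤ ordZero (c k).F ∧ ordZero (c k).F ≤ ((2 * q - 2 : ℕ) : ℕ∞) :=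
  isolated_chain_band hq (fun k => ⟨(hc k).1,
    (IsolatedScope.stepRule_iff_step0_of_isIsolated R hR (hc k).1).mp (hc k).2⟩) k

/-- **The band under MODE 1h** (the mode of record): along every `Step1h`-chain of isolated states
`q ≤ ord₀ F_k ≤ 2q − 2`. [folklore] -/
theorem isolated_step1hChain_band [DecidableEq K] {q : ℕ} (hq : 2 ≤ q) {c : ℕ → State K}
    (hc : ∀ k, IsIsolated q (c k).F ∧ Step1h q (c k) (c (k + 1))) (k : ℕ) :
    (q : ℕ∞) ≤ ordZero (c k).F ∧ ordZero (c k).F ≤ ((2 * q - 2 : ℕ) : ℕ∞) :=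
  isolated_chain_band hq (fun k => ⟨(hc k).1,
    (IsolatedScope.step1h_iff_step0_of_isIsolated (hc k).1).mp (hc k).2⟩) k

/-- **Any coordinate centre (MODE 2)**: a `Step2` edge ending at an isolated state was the blow-up of
a Hironaka-permissible centre `S` with `ord_{(x_S)} F ≤ 2q − 2` (the order ALONG THE CENTRE is what the
band bounds; the point order `ord₀ F ≥ ord_{(x_S)} F` is not bounded by this argument when `S ≠ univ`).
[folklore] -/
theorem exists_ordAlong_le_of_step2_of_isIsolated [DecidableEq K] {q : ℕ} (hq : 2 ≤ q)
    {s s' : State K} (h : Step2 q s s') (hiso : IsIsolated q s'.F) :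
    ∃ S, IsPermissibleCentre q S s.F ∧ ordAlong S s.F ≤ ((2 * q - 2 : ℕ) : ℕ∞) := by
  obtain ⟨S, hS, hedge⟩ := h
  exact ⟨S, hS, ordAlong_le_of_edge_of_isIsolated hq hedge hiso⟩

end IsolatedBand

end Summit.ResolutionOfSingularities.ResolutionOfSingularities.Theorems.PIDim4

end
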